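import Summits.KontsevichZagierPeriods.KontsevichZagierPeriods.Theorems.RootDecompWalshStrataQuadDescent03
import Summits.KontsevichZagierPeriods.KontsevichZagierPeriods.Theorems.RootDecompWalshStrataQuadricAssembly01
import Summits.KontsevichZagierPeriods.KontsevichZagierPeriods.Theses.RootDecompWalshStrata

/-!
# The quadric stratum `d ≤ 3`, part 2/2: constant fibre coefficient, `inBaker_cell3_all`, the conditional assembly

Declarations `Quadric₃.wc` … `quadricBakerDescent_of_sqrtDescent₂_of_multiAffine` of the farm-checked gen-7 file:
`A = 0` with `B ≡ b₀` (`clamp_wc_cases`, `inBaker_clampWc_atom` via `affineDescent₂_holds` / `quadDescent₂_holds`,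
`inBaker_cell3_of_const_neg/zero/pos`), the case analysis `Quadric₃.inBaker_cell3_all` (A ≠ 0 | c₂₂ ≠ 0 swap |
c₁₁ ≠ 0 swap | B constant | residual hM) and the CONDITIONAL proof of the route item
`Theses.RootDecompWalshStrata.QuadricBakerDescent` (stmt-KontsevichZagierPeriods-27597) from the two spelled-out
hypotheses hS (SqrtDescent₂ for every normal form) and hM (genuinely multi-affine cells); `d ≤ 2` is the landed
`quadricBakerDescent_two`.  See the module docstring of `RootDecompWalshStrataQuadricAssembly01` (part 1).
[KontsevichZagier2001 §1.2 rules (1)–(3); BCR1998 §2; this node gen 5–7]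
-/

noncomputable section

open Literature.NumberTheory.Transcendental
open MeasureTheory Set
open MvPolynomial (aeval X C)
open Literature.ModelTheory.ExponentialFields (IsSemialgebraic isSemialgebraic_univ
  isSemialgebraic_setOf_eval_pos isSemialgebraic_setOf_eval_lt isSemialgebraic_setOf_eval_le
  isSemialgebraic_setOf_eval_nonneg isSemialgebraic_setOf_eval_eq_zero
  isSemialgebraic_setOf_eval_ne_zero continuous_aeval_real tarski_seidenberg_real_holds)
open Summit.KontsevichZagierPeriods.RootDecompWalshStrata.WalshSpanProof (isSemialgebraic_cubeSet
  isBounded_cubeSet)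
open Summit.KontsevichZagierPeriods.RootDecompWalshStrata.ConeSpecimen (unitIoo isSemialgebraic_unitIoo
  unitIoo_subset_Icc mem_unitIoo)
open Summit.KontsevichZagierPeriods.RootDecompWalshStrata.PointlessOctant (boxTwo isSemialgebraic_boxTwo
  boxTwo_subset_Icc)

namespace Summit.KontsevichZagierPeriods.RootDecompWalshStrata.ConicDescent.BallCube

/-- `Fin.last 2 = 2` in `Fin 3` (PRIVATE copy of the CellThree01 helper; landed twin outside this chain,
gate lint `dedup.landed`). [folklore] -/
private theorem last_two₃ : (Fin.last 2 : Fin 3) = 2 := rfl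

/-- Constant `0` is `ℚ`-semialgebraic (PRIVATE copy, same reason). [BCR1998 §2.2] -/
private theorem isSemialgebraicFunOn_zero' {N : ℕ} {X : Set (Fin N → ℝ)} (hX : IsSemialgebraic ℚ X) :
    IsSemialgebraicFunOn ℚ X fun _ => (0 : ℝ) :=
  (isSemialgebraicFunOn_ratCast hX 0).congr fun _ _ => Rat.cast_zero

/-- Constant `1` is `ℚ`-semialgebraic (PRIVATE copy, same reason). [BCR1998 §2.2] -/
private theorem isSemialgebraicFunOn_one' {N : ℕ} {X : Set (Fin N → ℝ)} (hX : IsSemialgebraic ℚ X) :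
    IsSemialgebraicFunOn ℚ X fun _ => (1 : ℝ) :=
  (isSemialgebraicFunOn_ratCast hX 1).congr fun _ _ => Rat.cast_one

/-! #### 29.3 `A = 0` with a constant fibre coefficient `B ≡ b₀`: bands, atoms, conic weights -/

namespace Quadric₃

variable (K : Quadric₃)

/-- The fibre bound `w = −C(x,y)/b₀` of `p = b₀ z + C(x, y)`. -/
def wc (x y : ℝ) : ℝ := -K.Cxy x y / K.b0

/-- `w = −C/b₀` is semialgebraic over `ℚ`. [this node] -/
theorem isSemialgebraicFunOn_wc {X : Set (Fin 2 → ℝ)} (hX : IsSemialgebraic ℚ X) :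
    IsSemialgebraicFunOn ℚ X fun v => K.wc (v 0) (v 1) :=
  (isSemialgebraicFunOn_aeval hX (C (-1 / K.b0) * K.CxyP)).congr fun v _ => by
    simp only [map_mul, MvPolynomial.aeval_C, aeval_CxyP, eq_ratCast, wc]
    push_cast
    ring

/-- For `A = 0`, `B ≡ b₀`: `C₁ = b₀ + C₀`. [this node] -/
theorem C1xy_eq_of_const (hA : K.A = 0) (hb1 : K.b1 = 0) (hb2 : K.b2 = 0) (x y : ℝ) :
    K.C1xy x y = K.b0 + K.Cxy x y := by
  simp [C1xy, Bxy, hA, hb1, hb2]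

/-- For `A = 0`, `B ≡ b₀`: `p(x, y, z) = b₀ z + C₀(x, y)`. [this node] -/
theorem pxyz_eq_of_const (hA : K.A = 0) (hb1 : K.b1 = 0) (hb2 : K.b2 = 0) (x y z : ℝ) :
    K.pxyz x y z = K.b0 * z + K.Cxy x y := by
  simp [pxyz, Bxy, hA, hb1, hb2]

/-- **Clamp regimes of `w = −C/b₀` are decided by the atom** (`A = 0`, `B ≡ b₀ ≠ 0`): on `K.atom σ`
the bound is everywhere `≤ 0`, or everywhere `≥ 1`, or everywhere in `(0, 1)` — read off from the
signs `σ 1` of `C₀` and `σ 2` of `C₁ = b₀ + C₀`. [this node] -/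
theorem clamp_wc_cases (hA : K.A = 0) (hb1 : K.b1 = 0) (hb2 : K.b2 = 0) (hb0 : K.b0 ≠ 0)
    (σ : Fin 5 → SignType) :
    (∀ v ∈ K.atom σ, K.wc (v 0) (v 1) ≤ 0) ∨ (∀ v ∈ K.atom σ, 1 ≤ K.wc (v 0) (v 1)) ∨
      (∀ v ∈ K.atom σ, 0 < K.wc (v 0) (v 1) ∧ K.wc (v 0) (v 1) < 1) := by
  have hC1 := K.C1xy_eq_of_const hA hb1 hb2
  rcases lt_or_gt_of_ne hb0 with hb | hb
  · -- `b₀ < 0`: `w = C₀/|b₀|`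
    have hb' : (K.b0 : ℝ) < 0 := by exact_mod_cast hb
    by_cases h1 : σ 1 = 1
    · by_cases h2 : σ 2 = -1
      · refine Or.inr (Or.inr fun v hv => ?_)
        obtain ⟨-, s1, s2, -, -⟩ := K.atom_sign σ hv
        have hC : 0 < K.Cxy (v 0) (v 1) := sign_eq_one_iff.1 (s1.trans h1)
        have hC' : K.C1xy (v 0) (v 1) < 0 := sign_eq_neg_one_iff.1 (s2.trans h2)
        rw [hC1] at hC'
        refine ⟨by rw [wc, lt_div_iff_of_neg hb']; linarith, by rw [wc, div_lt_iff_of_neg hb']; linarith⟩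
      · refine Or.inr (Or.inl fun v hv => ?_)
        obtain ⟨-, -, s2, -, -⟩ := K.atom_sign σ hv
        have hC' : 0 ≤ K.C1xy (v 0) (v 1) :=
          not_lt.1 fun h => h2 (s2.symm.trans (sign_eq_neg_one_iff.2 h))
        rw [hC1] at hC'
        rw [wc, le_div_iff_of_neg hb']
        linarith
    · refine Or.inl fun v hv => ?_
      obtain ⟨-, s1, -, -, -⟩ := K.atom_sign σ hv
      have hC : K.Cxy (v 0) (v 1) ≤ 0 := not_lt.1 fun h => h1 (s1.symm.trans (sign_eq_one_iff.2 h))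
      rw [wc, div_le_iff_of_neg hb']
      linarith
  · -- `b₀ > 0`: `w = −C₀/b₀`
    have hb' : (0 : ℝ) < K.b0 := by exact_mod_cast hb
    by_cases h1 : σ 1 = -1
    · by_cases h2 : σ 2 = 1
      · refine Or.inr (Or.inr fun v hv => ?_)
        obtain ⟨-, s1, s2, -, -⟩ := K.atom_sign σ hv
        have hC : K.Cxy (v 0) (v 1) < 0 := sign_eq_neg_one_iff.1 (s1.trans h1)
        have hC' : 0 < K.C1xy (v 0) (v 1) := sign_eq_one_iff.1 (s2.trans h2)
        rw [hC1] at hC'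
        refine ⟨by rw [wc, lt_div_iff₀ hb']; linarith, by rw [wc, div_lt_iff₀ hb']; linarith⟩
      · refine Or.inr (Or.inl fun v hv => ?_)
        obtain ⟨-, -, s2, -, -⟩ := K.atom_sign σ hv
        have hC' : K.C1xy (v 0) (v 1) ≤ 0 :=
          not_lt.1 fun h => h2 (s2.symm.trans (sign_eq_one_iff.2 h))
        rw [hC1] at hC'
        rw [wc, le_div_iff₀ hb']
        linarith
    · refine Or.inl fun v hv => ?_
      obtain ⟨-, s1, -, -, -⟩ := K.atom_sign σ hv
      have hC : 0 ≤ K.Cxy (v 0) (v 1) :=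
        not_lt.1 fun h => h1 (s1.symm.trans (sign_eq_neg_one_iff.2 h))
      rw [wc, div_le_iff₀ hb']
      linarith

/-- **One clamped fibre bound on one atom** (`A = 0`, `B ≡ b₀ ≠ 0`): `[K.atom σ, s·κ(−C/b₀)]` lands
in the Baker sector modulo relations — zero, the constant `s` (`affineDescent₂_holds`), or the conic
weight `−(s/b₀)·C₀(x, y)` (`quadDescent₂_holds`). [KontsevichZagier2001 §1.2; this node] -/
theorem inBaker_clampWc_atom (hA : K.A = 0) (hb1 : K.b1 = 0) (hb2 : K.b2 = 0) (hb0 : K.b0 ≠ 0)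
    (σ : Fin 5 → SignType) (s : ℚ) (r : KZ.IntegralRep 2) (hrd : r.domain = K.atom σ)
    (hri : EqOn r.integrand (fun v => (s : ℝ) * clamp (K.wc (v 0) (v 1))) r.domain) :
    InBaker (KZ.of r) := by
  rcases K.clamp_wc_cases hA hb1 hb2 hb0 σ with h | h | h
  · refine InBaker.of_mem_relations (KZ.of_mem_relations_of_eqOn_zero r fun v hv => ?_)
    rw [hri hv]
    simp [clamp_of_nonpos (h v (hrd ▸ hv))]
  · refine affineDescent₂_holds K s 0 0 σ r hrd fun v hv => ?_
    rw [hri hv]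
    simp [clamp_of_one_le (h v (hrd ▸ hv))]
  · refine quadDescent₂_holds K ⟨-(s * K.c22) / K.b0, -(s * K.c2) / K.b0, -(s * K.c12) / K.b0,
      -(s * K.c0) / K.b0, -(s * K.c1) / K.b0, -(s * K.c11) / K.b0⟩ σ r hrd fun v hv => ?_
    have hv' : v ∈ K.atom σ := by rw [← hrd]; exact hv
    obtain ⟨h0, h1⟩ := h v hv'
    rw [hri hv]
    beta_reduce
    rw [clamp_of_mem h0.le h1.le]
    simp only [wc, Cxy, Conic.pxy, Conic.Bx, Conic.Cx]
    have hb0' : (K.b0 : ℝ) ≠ 0 := by exact_mod_cast hb0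
    push_cast
    field_simp
    ring

/-- The length integrand `q·(1 − κ(−C₀/b₀))` on one atom (`A = 0`, `B ≡ b₀ ≠ 0`): the constant `q`
(`affineDescent₂_holds`) minus `q·κw` (`inBaker_clampWc_atom`). [this node] -/
theorem inBaker_oneSubClampWc_atom (hA : K.A = 0) (hb1 : K.b1 = 0) (hb2 : K.b2 = 0) (hb0 : K.b0 ≠ 0)
    (σ : Fin 5 → SignType) (q : ℚ) (r : KZ.IntegralRep 2) (hrd : r.domain = K.atom σ)
    (hri : EqOn r.integrand (fun v => (q : ℝ) * (1 - clamp (K.wc (v 0) (v 1)))) r.domain) :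
    InBaker (KZ.of r) := by
  have hI : r.domain ⊆ Icc 0 1 := hrd ▸ fun v hv => boxTwo_subset_Icc hv.1
  set r₂ : KZ.IntegralRep 2 := polyRep₁ r.domain r.isSemialgebraic_domain hI (C q) with hr₂
  have h₂ : InBaker (KZ.of r₂) :=
    affineDescent₂_holds K q 0 0 σ r₂ (by rw [hr₂, polyRep₁_domain, hrd]) fun v _ => by simp [hr₂]
  refine InBaker.of_sub' r r₂ rfl h₂ (K.inBaker_clampWc_atom hA hb1 hb2 hb0 σ (-q) _
    (by rw [subRep_domain, hrd]) fun v hv => ?_)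
  rw [subRep_integrand, hri hv]
  simp only [hr₂, polyRep₁_integrand, MvPolynomial.aeval_C, eq_ratCast]
  push_cast
  ring

/-- **`A = 0`, `B ≡ b₀ > 0`.** `[cell, q]` lands in the Baker sector: the cell is the band over
`(0,1)²` between `κ(−C₀/b₀)` and `1` (rule 3), the length integrand `q(1 − κw)` is treated atom by
atom (`InBaker.of_partition`, `inBaker_clampWc_atom`). [KontsevichZagier2001 §1.2; this node] -/
theorem inBaker_cell3_of_const_pos (hA : K.A = 0) (hb1 : K.b1 = 0) (hb2 : K.b2 = 0) (hb0 : 0 < K.b0)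
    (q : ℚ) (ρ : KZ.IntegralRep 3) (hdom : ρ.domain = K.cell)
    (hint : ∀ z ∈ ρ.domain, ρ.integrand z = q) : InBaker (KZ.of ρ) := by
  classical
  have hb0' : (0 : ℝ) < K.b0 := by exact_mod_cast hb0
  have hl := IsSemialgebraicFunOn.clamp isSemialgebraic_boxTwo
    (K.isSemialgebraicFunOn_wc isSemialgebraic_boxTwo)
  have key : ∀ x y t : ℝ, 0 < K.pxyz x y t ↔ K.wc x y < t := fun x y t => by
    rw [K.pxyz_eq_of_const hA hb1 hb2, wc, div_lt_iff₀ hb0']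
    constructor <;> intro h <;> linarith
  have hdomeq : ρ.domain = oband boxTwo (fun v => clamp (K.wc (v 0) (v 1))) fun _ => 1 := by
    rw [hdom]
    ext z
    simp only [Quadric₃.cell, mem_setOf_eq, mem_oband, cube_iff, init₃_apply_zero,
      init₃_apply_one, last_two₃, key]
    constructor
    · rintro ⟨⟨h2, hz0, hz1⟩, hp⟩
      exact ⟨h2, (clamp_lt_iff hz0 hz1).2 hp, hz1⟩
    · rintro ⟨h2, hlo, hz1⟩
      have hz0 : 0 < z 2 := (clamp_nonneg _).trans_lt hlo
      exact ⟨⟨h2, hz0, hz1⟩, (clamp_lt_iff hz0 hz1).1 hlo⟩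
  refine InBaker.of_band ρ boxTwo isSemialgebraic_boxTwo boxTwo_subset_Icc _ _ hl
    (isSemialgebraicFunOn_one' isSemialgebraic_boxTwo) (fun v _ => clamp_nonneg _)
    (fun v _ => clamp_le_one _) (fun v _ => le_rfl) q hdomeq hint ?_
  refine InBaker.of_partition (Finset.univ : Finset (Fin 5 → SignType)) _ (fun σ => K.atom σ)
    (fun σ _ => K.isSemialgebraic_atom σ) (fun v hv => ⟨_, Finset.mem_univ _, K.mem_atom_sign hv⟩)
    (fun σ τ v hne h₁ h₂ => hne (K.atom_eq_of_mem h₁ h₂)) fun σ _ T hT hTr hTeq => ?_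
  have hTa : T = K.atom σ := by
    rw [hTeq]; exact inter_eq_right.2 (K.atom_subset_boxTwo σ)
  exact K.inBaker_oneSubClampWc_atom hA hb1 hb2 hb0.ne' σ q _ hTa fun v _ => rfl

/-- **`A = 0`, `B ≡ b₀ < 0`.** `[cell, q]` lands in the Baker sector: the cell is the band over
`(0,1)²` between `0` and `κ(−C₀/b₀)`. [KontsevichZagier2001 §1.2; this node] -/
theorem inBaker_cell3_of_const_neg (hA : K.A = 0) (hb1 : K.b1 = 0) (hb2 : K.b2 = 0) (hb0 : K.b0 < 0)
    (q : ℚ) (ρ : KZ.IntegralRep 3) (hdom : ρ.domain = K.cell)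
    (hint : ∀ z ∈ ρ.domain, ρ.integrand z = q) : InBaker (KZ.of ρ) := by
  classical
  have hb0' : (K.b0 : ℝ) < 0 := by exact_mod_cast hb0
  have hu := IsSemialgebraicFunOn.clamp isSemialgebraic_boxTwo
    (K.isSemialgebraicFunOn_wc isSemialgebraic_boxTwo)
  have key : ∀ x y t : ℝ, 0 < K.pxyz x y t ↔ t < K.wc x y := fun x y t => by
    rw [K.pxyz_eq_of_const hA hb1 hb2, wc, lt_div_iff_of_neg hb0']
    constructor <;> intro h <;> linarith
  have hdomeq : ρ.domain = oband boxTwo (fun _ => 0) fun v => clamp (K.wc (v 0) (v 1)) := by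
    rw [hdom]
    ext z
    simp only [Quadric₃.cell, mem_setOf_eq, mem_oband, cube_iff, init₃_apply_zero,
      init₃_apply_one, last_two₃, key]
    constructor
    · rintro ⟨⟨h2, hz0, hz1⟩, hp⟩
      exact ⟨h2, hz0, (lt_clamp_iff hz0 hz1).2 hp⟩
    · rintro ⟨h2, hz0, hhi⟩
      have hz1 : z 2 < 1 := hhi.trans_le (clamp_le_one _)
      exact ⟨⟨h2, hz0, hz1⟩, (lt_clamp_iff hz0 hz1).1 hhi⟩
  refine InBaker.of_band ρ boxTwo isSemialgebraic_boxTwo boxTwo_subset_Icc _ _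
    (isSemialgebraicFunOn_zero' isSemialgebraic_boxTwo) hu (fun v _ => le_rfl)
    (fun v _ => clamp_nonneg _) (fun v _ => clamp_le_one _) q hdomeq hint ?_
  refine InBaker.of_partition (Finset.univ : Finset (Fin 5 → SignType)) _ (fun σ => K.atom σ)
    (fun σ _ => K.isSemialgebraic_atom σ) (fun v hv => ⟨_, Finset.mem_univ _, K.mem_atom_sign hv⟩)
    (fun σ τ v hne h₁ h₂ => hne (K.atom_eq_of_mem h₁ h₂)) fun σ _ T hT hTr hTeq => ?_
  have hTa : T = K.atom σ := by
    rw [hTeq]; exact inter_eq_right.2 (K.atom_subset_boxTwo σ)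
  refine K.inBaker_clampWc_atom hA hb1 hb2 hb0.ne σ q _ hTa fun v _ => ?_
  show (q : ℝ) * (clamp (K.wc (v 0) (v 1)) - 0) = q * clamp (K.wc (v 0) (v 1))
  rw [sub_zero]

/-- **`A = 0`, `B ≡ 0`: no fibre variable at all.** `[cell, q]` for `p = C₀(x, y)` is the band
`{C₀ > 0} × (0,1)` (rule 3); its base `{v ∈ (0,1)² | C₀ > 0}` is the disjoint union of the adapted
atoms with `σ 1 = 1`, on each of which the weight is the constant `q` (`affineDescent₂_holds`).
[KontsevichZagier2001 §1.2; this node] -/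
theorem inBaker_cell3_of_const_zero (hA : K.A = 0) (hb0 : K.b0 = 0) (hb1 : K.b1 = 0) (hb2 : K.b2 = 0)
    (q : ℚ) (ρ : KZ.IntegralRep 3) (hdom : ρ.domain = K.cell)
    (hint : ∀ z ∈ ρ.domain, ρ.integrand z = q) : InBaker (KZ.of ρ) := by
  classical
  set W : Set (Fin 2 → ℝ) := {v | v ∈ boxTwo ∧ 0 < K.Cxy (v 0) (v 1)} with hWdef
  have hW : IsSemialgebraic ℚ W := by
    convert isSemialgebraic_boxTwo.inter (isSemialgebraic_setOf_eval_pos (R := ℝ) K.CxyP) using 1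
    ext v
    simp only [hWdef, mem_setOf_eq, mem_inter_iff, aeval_CxyP]
  have hWI : W ⊆ Icc 0 1 := fun v hv => boxTwo_subset_Icc hv.1
  have key : ∀ x y t : ℝ, K.pxyz x y t = K.Cxy x y := fun x y t => by
    rw [K.pxyz_eq_of_const hA hb1 hb2, hb0]; push_cast; ring
  have hdomeq : ρ.domain = oband W (fun _ => 0) fun _ => 1 := by
    rw [hdom]
    ext z
    simp only [Quadric₃.cell, mem_setOf_eq, mem_oband, cube_iff, init₃_apply_zero,
      init₃_apply_one, last_two₃, key, hWdef]
    constructor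
    · rintro ⟨⟨h2, hz0, hz1⟩, hp⟩
      exact ⟨⟨h2, hp⟩, hz0, hz1⟩
    · rintro ⟨⟨h2, hp⟩, hz0, hz1⟩
      exact ⟨⟨h2, hz0, hz1⟩, hp⟩
  refine InBaker.of_band ρ W hW hWI _ _ (isSemialgebraicFunOn_zero' hW)
    (isSemialgebraicFunOn_one' hW) (fun v _ => le_rfl) (fun v _ => zero_le_one) (fun v _ => le_rfl)
    q hdomeq hint ?_
  refine InBaker.of_partition (Finset.univ : Finset (Fin 5 → SignType)) _ (fun σ => K.atom σ)
    (fun σ _ => K.isSemialgebraic_atom σ) (fun v hv => ⟨_, Finset.mem_univ _, K.mem_atom_sign hv.1⟩)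
    (fun σ τ v hne h₁ h₂ => hne (K.atom_eq_of_mem h₁ h₂)) fun σ _ T hT hTr hTeq => ?_
  by_cases h1 : σ 1 = 1
  · have hTa : T = K.atom σ := by
      rw [hTeq]
      refine inter_eq_right.2 fun v hv => ⟨hv.1, ?_⟩
      obtain ⟨-, s1, -, -, -⟩ := K.atom_sign σ hv
      exact sign_eq_one_iff.1 (s1.trans h1)
    exact affineDescent₂_holds K q 0 0 σ _ hTa fun v _ => by simp [lenRep]
  · refine InBaker.of_domain_eq_empty _ ?_
    show T = ∅
    rw [hTeq]
    ext v
    simp only [mem_inter_iff, mem_empty_iff_false, iff_false, not_and]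
    intro hvW hv
    obtain ⟨-, s1, -, -, -⟩ := K.atom_sign σ hv
    exact h1 (s1.symm.trans (sign_eq_one_iff.2 hvW.2))

/-! #### 29.4 The quadric stratum `d ≤ 3` modulo `SqrtDescent₂` and the genuinely multi-affine cells -/

/-- **Every weighted quadric cell in dimension three**, modulo the two typed residuals: (i) `hS` =
`SqrtDescent₂ K γ` for every normal form `K` and every `γ ∈ ℚ` (square roots of the fibre
discriminant on adapted atoms), (ii) `hM` = the GENUINELY MULTI-AFFINE cells (`A = c₁₁ = c₂₂ = 0`
and `(b₁, b₂) ≠ 0`: no square term and a non-constant fibre coefficient, fibre bound `−C/B` a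
genuine ratio).  Cases: `A ≠ 0` is `inBaker_cell3`; `A = 0, c₂₂ ≠ 0` and `A = c₂₂ = 0, c₁₁ ≠ 0`
become `A ≠ 0` after the coordinate swap `y ↔ z`, resp. `x ↔ z` (`inBaker_cell3_of_perm`);
`B ≡ b₀` constant is `inBaker_cell3_of_const_neg/zero/pos`; the rest is `hM`.
[KontsevichZagier2001 §1.2; this node] -/
theorem inBaker_cell3_all
    (hS : ∀ (K : Quadric₃) (γ : ℚ) (σ : Fin 5 → SignType) (r : KZ.IntegralRep 2),
      r.domain = K.atom σ → EqOn r.integrand (fun v => (γ : ℝ) * √(K.Dxy (v 0) (v 1))) r.domain →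
        InBaker (KZ.of r))
    (hM : ∀ K : Quadric₃, K.A = 0 → K.c11 = 0 → K.c22 = 0 → ¬(K.b1 = 0 ∧ K.b2 = 0) →
      ∀ (q : ℚ) (ρ : KZ.IntegralRep 3), ρ.domain = K.cell → (∀ z ∈ ρ.domain, ρ.integrand z = q) →
        InBaker (KZ.of ρ))
    (K : Quadric₃) (q : ℚ) (ρ : KZ.IntegralRep 3) (hdom : ρ.domain = K.cell)
    (hint : ∀ z ∈ ρ.domain, ρ.integrand z = q) : InBaker (KZ.of ρ) := by
  by_cases hA : K.A = 0
  swap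
  · exact K.inBaker_cell3 hA q (hS K) ρ hdom hint
  by_cases h22 : K.c22 = 0
  swap
  · have hp : ∀ j : Fin 3, (Equiv.swap (1 : Fin 3) 2) ((Equiv.swap (1 : Fin 3) 2) j) = j := by
      decide
    exact inBaker_cell3_of_perm K K.swapYZ _ hp K.comp_swapYZ_mem_cell_iff q
      (fun ρ' h1 h2 => K.swapYZ.inBaker_cell3 (by rwa [swapYZ_A]) q (hS K.swapYZ) ρ' h1 h2)
      ρ hdom hint
  by_cases h11 : K.c11 = 0
  swap
  · have hp : ∀ j : Fin 3, (Equiv.swap (0 : Fin 3) 2) ((Equiv.swap (0 : Fin 3) 2) j) = j := by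
      decide
    exact inBaker_cell3_of_perm K K.swapXZ _ hp K.comp_swapXZ_mem_cell_iff q
      (fun ρ' h1 h2 => K.swapXZ.inBaker_cell3 (by rwa [swapXZ_A]) q (hS K.swapXZ) ρ' h1 h2)
      ρ hdom hint
  by_cases hb : K.b1 = 0 ∧ K.b2 = 0
  · rcases lt_trichotomy K.b0 0 with hb0 | hb0 | hb0
    · exact K.inBaker_cell3_of_const_neg hA hb.1 hb.2 hb0 q ρ hdom hint
    · exact K.inBaker_cell3_of_const_zero hA hb0 hb.1 hb.2 q ρ hdom hint
    · exact K.inBaker_cell3_of_const_pos hA hb.1 hb.2 hb0 q ρ hdom hint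
  exact hM K hA h11 h22 hb q ρ hdom hint

end Quadric₃

/-- **The quadric stratum `d ≤ 3` of the rung, reduced to its two minimal open configurations.**
The support item `QuadricBakerDescent` of route `RootDecompWalshStrata` (every weighted quadric Walsh
cell `[(0,1)^d ∩ {P > 0}, q]`, `deg P ≤ 2`, `d ≤ 3`, `q ∈ ℚ`, is congruent modulo `KZ.relations` to an
element of the Baker sector) FOLLOWS from
(i) `SqrtDescent₂` for every quadric normal form — `[atom_σ(K), γ·√D_K] ∈` Baker sector mod relations
    for the adapted atoms of `K` (two-dimensional, genus-0 data: `D_K` restricted to `{C₀ = 0}` and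
    `{C₁ = 0}` is a square), and
(ii) the genuinely multi-affine cells — `[(0,1)³ ∩ {p > 0}, q]` for `p` with NO square term
    (`A = c₁₁ = c₂₂ = 0`) and a NON-CONSTANT fibre coefficient `B` (`(b₁, b₂) ≠ 0`; fibre bound
    `−C/B` the ratio of a bilinear by a non-constant affine function):
`d ≤ 2` is the landed `quadricBakerDescent_two`; `d = 3` is the normal form
(`exists_quadric₃_of_totalDegree_le_two`) and `Quadric₃.inBaker_cell3_all`.  Tag: CONDITIONAL proof
of the item — the two hypotheses are the typed residual leaves of the `d = 3` slice (lens 4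
«extremal reduction», NODE.md gen 7). [KontsevichZagier2001 §1.2 rules (1)–(3); Baker1975 Thm 2.1
for the use of the sector downstream; this node] -/
theorem quadricBakerDescent_of_sqrtDescent₂_of_multiAffine
    (hS : ∀ (K : Quadric₃) (γ : ℚ) (σ : Fin 5 → SignType) (r : KZ.IntegralRep 2),
      r.domain = K.atom σ → EqOn r.integrand (fun v => (γ : ℝ) * √(K.Dxy (v 0) (v 1))) r.domain →
        InBaker (KZ.of r))
    (hM : ∀ K : Quadric₃, K.A = 0 → K.c11 = 0 → K.c22 = 0 → ¬(K.b1 = 0 ∧ K.b2 = 0) →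
      ∀ (q : ℚ) (ρ : KZ.IntegralRep 3), ρ.domain = K.cell → (∀ z ∈ ρ.domain, ρ.integrand z = q) →
        InBaker (KZ.of ρ)) :
    Summit.KontsevichZagierPeriods.KontsevichZagierPeriods.Theses.RootDecompWalshStrata.QuadricBakerDescent := by
  intro d P q ρ hρ hP hd
  rcases Nat.lt_or_ge d 3 with hd3 | hd3
  · exact quadricBakerDescent_two d P q ρ hρ hP (by omega)
  obtain rfl : d = 3 := le_antisymm hd hd3
  obtain ⟨hdom, hint⟩ := hρ
  obtain ⟨K, hK⟩ := exists_quadric₃_of_totalDegree_le_two P hP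
  have hdom' : ρ.domain = K.cell := by
    rw [hdom]
    ext z
    simp only [mem_setOf_eq, Quadric₃.cell, hK]
  change InBaker (KZ.of ρ)
  exact Quadric₃.inBaker_cell3_all hS hM K q ρ hdom' hint

end Summit.KontsevichZagierPeriods.RootDecompWalshStrata.ConicDescent.BallCube
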